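import Summits.CriticalPhenomena.PercolationContinuityZ3.Theorems.TransplantHeisenberg
import Literature.Barriers.CriticalPhenomena.BLPSCriticalReduction
import Mathlib.Analysis.SpecificLimits.Normed
import HarnessLib

/-!
# `Cay(H₃(ℤ), {A^±, B^±})` has polynomial growth and is amenable

Builds on p205010 (kernel theorem, internal audit signed; external expert review pending).  Lane
`prim-bschramm`, class C2 (memo `run/shared/lean/prim/bschramm/P3-NILPOTENT.md` §1 row "Burton–Keane", §10.2).
Proof-only sequel of `TransplantHeisenberg.lean` (p207302).

* `walk_bounds`: along a walk of length `L` from `u`, the coordinates `a, b` move by at most `L` and `c`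
  by at most `L (|a(u)| + L)` (an `A`-step fixes `c`, a `B`-step moves it by the current `a`);
* `ballVolume_heis_le`: `|B(0,n)| ≤ (2n+1)² (2n²+1)` (the ball lies in the box `{|a|,|b| ≤ n, |c| ≤ n²}`)
  — growth of degree at most `4`;
* `not_hasExponentialGrowth_heis`: hence NOT of exponential growth (tree predicate `HasExponentialGrowth`);
* `heisenbergGraph_amenable : IsGraphAmenable heisenbergGraph` — by the tree's contrapositive
  `hasExponentialGrowth_of_not_isGraphAmenable` (Lyons–Peres §6.1: nonamenable quasi-transitive graphs grow
  exponentially).  This is hypothesis U of the lane (Burton–Keane uniqueness,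
  `BurtonKeane1989_atMostOneInfiniteCluster_holds`, hence KN Lemma 7) for every rung built on `H₃`.
[cite: LyonsPeres2016, §6.1 (p. 279)] [cite: BurtonKeane1989]
-/

noncomputable section

namespace Summit.CriticalPhenomena.PercolationContinuityZ3.Theorems.Heisenberg

open Filter Literature.Probability.Percolation Literature.Probability.LatticeModels
open Literature.Barriers.CriticalPhenomena (IsGraphAmenable IsQuasiTransitive HasExponentialGrowth graphBall
  ballVolume hasExponentialGrowth_of_not_isGraphAmenable)

/-- One step of the Cayley graph moves `a`, `b` by at most one and `c` by at most `|a|`. [folklore] -/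
theorem adj_coord_bounds {x y : HV} (h : heisenbergGraph.Adj x y) :
    |y 0 - x 0| ≤ 1 ∧ |y 1 - x 1| ≤ 1 ∧ |y 2 - x 2| ≤ |x 0| := by
  rw [heisenbergGraph_adj] at h
  obtain ⟨-, (h | h) | (h | h)⟩ := h
  · subst h; simp [heisMul, genA]
  · subst h; simp [heisMul, genB]
  · rw [h]
    refine ⟨?_, ?_, ?_⟩ <;> simp [heisMul, genA]
  · rw [h]
    refine ⟨?_, ?_, ?_⟩ <;> simp [heisMul, genB]

/-- Along a walk of length `L`: `|Δa|, |Δb| ≤ L` and `|Δc| ≤ L (|a(start)| + L)`. [folklore] -/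
theorem walk_bounds {u v : HV} (w : heisenbergGraph.Walk u v) :
    |v 0 - u 0| ≤ w.length ∧ |v 1 - u 1| ≤ w.length ∧
      |v 2 - u 2| ≤ w.length * (|u 0| + w.length) := by
  induction w with
  | nil => simp
  | @cons a b c hab w ih =>
    obtain ⟨h0, h1, h2⟩ := adj_coord_bounds hab
    obtain ⟨i0, i1, i2⟩ := ih
    simp only [SimpleGraph.Walk.length_cons]
    push_cast
    set L : ℤ := (w.length : ℤ) with hL
    have hL0 : 0 ≤ L := by rw [hL]; positivity
    refine ⟨?_, ?_, ?_⟩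
    · calc |c 0 - a 0| = |(c 0 - b 0) + (b 0 - a 0)| := by ring_nf
        _ ≤ |c 0 - b 0| + |b 0 - a 0| := abs_add_le _ _
        _ ≤ L + 1 := add_le_add i0 h0
    · calc |c 1 - a 1| = |(c 1 - b 1) + (b 1 - a 1)| := by ring_nf
        _ ≤ |c 1 - b 1| + |b 1 - a 1| := abs_add_le _ _
        _ ≤ L + 1 := add_le_add i1 h1
    · have hb : |b 0| ≤ |a 0| + 1 := by
        have := abs_sub_abs_le_abs_sub (b 0) (a 0)
        linarith
      have htri : |c 2 - a 2| ≤ |c 2 - b 2| + |b 2 - a 2| := by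
        calc |c 2 - a 2| = |(c 2 - b 2) + (b 2 - a 2)| := by ring_nf
          _ ≤ |c 2 - b 2| + |b 2 - a 2| := abs_add_le _ _
      have ha0 : 0 ≤ |a 0| := abs_nonneg _
      nlinarith [htri, i2, h2, hb, hL0, ha0, mul_le_mul_of_nonneg_left hb hL0]

/-- The ball of radius `n` lies in the box `{|a| ≤ n, |b| ≤ n, |c| ≤ n²}`. [folklore] -/
theorem graphBall_heis_subset (n : ℕ) : graphBall heisenbergGraph 0 n ⊆
    ↑((Finset.Icc (-(n : ℤ)) n ×ˢ Finset.Icc (-(n : ℤ)) n ×ˢ Finset.Icc (-(n : ℤ) ^ 2) ((n : ℤ) ^ 2)).image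
      (fun t : ℤ × ℤ × ℤ => (![t.1, t.2.1, t.2.2] : HV))) := by
  rintro y ⟨w, hw⟩
  obtain ⟨h0, h1, h2⟩ := walk_bounds w
  simp only [Pi.zero_apply, sub_zero, abs_zero, zero_add] at h0 h1 h2
  have hL : (w.length : ℤ) ≤ n := by exact_mod_cast hw
  have hL0 : (0 : ℤ) ≤ w.length := by positivity
  rw [Finset.coe_image]
  refine ⟨(y 0, y 1, y 2), ?_, by ext i; fin_cases i <;> rfl⟩
  simp only [Finset.mem_coe, Finset.mem_product, Finset.mem_Icc]
  have h2' : |y 2| ≤ (n : ℤ) ^ 2 := h2.trans (by nlinarith)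
  exact ⟨⟨by linarith [(abs_le.1 h0).1], by linarith [(abs_le.1 h0).2]⟩,
    ⟨by linarith [(abs_le.1 h1).1], by linarith [(abs_le.1 h1).2]⟩,
    by linarith [(abs_le.1 h2').1], by linarith [(abs_le.1 h2').2]⟩

/-- **Polynomial growth**: `|B(0,n)| ≤ (2n+1)² (2n²+1)`. [folklore] -/
theorem ballVolume_heis_le (n : ℕ) :
    ballVolume heisenbergGraph 0 n ≤ (2 * n + 1) * (2 * n + 1) * (2 * n ^ 2 + 1) := by
  unfold ballVolume
  refine (Set.ncard_le_ncard (graphBall_heis_subset n) (Finset.finite_toSet _)).trans ?_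
  rw [Set.ncard_coe_finset]
  refine Finset.card_image_le.trans ?_
  simp only [Finset.card_product, Int.card_Icc]
  have e1 : ((n : ℤ) + 1 - -(n : ℤ)).toNat = 2 * n + 1 := by omega
  have e2 : ((n : ℤ) ^ 2 + 1 - -(n : ℤ) ^ 2).toNat = 2 * n ^ 2 + 1 := by
    have : (n : ℤ) ^ 2 + 1 - -(n : ℤ) ^ 2 = ((2 * n ^ 2 + 1 : ℕ) : ℤ) := by push_cast; ring
    rw [this, Int.toNat_natCast]
  rw [e1, e2, mul_assoc]

/-- `Cay(H₃(ℤ))` does not have exponential growth (tree predicate). [folklore] -/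
theorem not_hasExponentialGrowth_heis : ¬ HasExponentialGrowth heisenbergGraph := by
  intro h
  obtain ⟨c, hc, hev⟩ := h 0
  -- `27 n⁴ / c^n → 0`, so eventually `27 n⁴ < c^n`
  have hlim := (tendsto_pow_const_div_const_pow_of_one_lt 4 hc).const_mul 27
  rw [mul_zero] at hlim
  have hev2 : ∀ᶠ n : ℕ in atTop, (27 : ℝ) * n ^ 4 < c ^ n := by
    filter_upwards [hlim.eventually (gt_mem_nhds zero_lt_one)] with n hn
    have hcn : (0 : ℝ) < c ^ n := pow_pos (by linarith) n
    rw [← mul_div_assoc, div_lt_one hcn] at hn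
    exact hn
  obtain ⟨n, ⟨hn1, hn2⟩, hn3⟩ := ((hev.and hev2).and (eventually_ge_atTop 1)).exists
  have hvol : (ballVolume heisenbergGraph 0 n : ℝ) ≤ 27 * (n : ℝ) ^ 4 := by
    have h1 := ballVolume_heis_le n
    have h2 : (2 * n + 1) * (2 * n + 1) * (2 * n ^ 2 + 1) ≤ 27 * n ^ 4 := by
      have hn : 1 ≤ n := hn3
      have e : (2 * n + 1) * (2 * n + 1) * (2 * n ^ 2 + 1) = 8 * n ^ 4 + 8 * n ^ 3 + 6 * n ^ 2 + 4 * n + 1 := by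
        ring
      rw [e]
      have h3 : n ^ 3 ≤ n ^ 4 := pow_le_pow_right₀ hn (by norm_num)
      have h2' : n ^ 2 ≤ n ^ 4 := pow_le_pow_right₀ hn (by norm_num)
      have h1' : n ^ 1 ≤ n ^ 4 := pow_le_pow_right₀ hn (by norm_num)
      have h0' : 1 ≤ n ^ 4 := Nat.one_le_pow 4 n hn
      rw [pow_one] at h1'
      linarith
    exact_mod_cast h1.trans h2
  linarith

/-- **`Cay(H₃(ℤ), {A^±, B^±})` is amenable** (hypothesis U of the lane: with quasi-transitivity it feeds
`BurtonKeane1989_atMostOneInfiniteCluster_holds`). [cite: LyonsPeres2016, §6.1 (p. 279)] -/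
theorem heisenbergGraph_amenable : IsGraphAmenable heisenbergGraph := by
  by_contra h
  exact not_hasExponentialGrowth_heis
    (hasExponentialGrowth_of_not_isGraphAmenable heisenbergGraph heisenbergGraph_quasiTransitive h)

end Summit.CriticalPhenomena.PercolationContinuityZ3.Theorems.Heisenberg
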